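import Literature.Topology.FourManifolds.LinkTubularUniqueness
import Literature.Topology.FourManifolds.TubeTwistDiffeo
import Literature.Topology.FourManifolds.CircleDiffeotopyProofs
import HarnessLib

/-!
# Two families of tubular neighbourhoods of a link agree, near the link, up to rotations `R(dθ)`

Topic `Literature/Topology/FourManifolds`; step (S3) of the proof of the named fact
`Literature.Topology.FourManifolds.FramedLink.IsSurgery.nonempty_diffeomorph` (`KirbyMovesSurgery.lean`:
uniqueness of Dehn surgery on a framed link, leaf (U) of Kirby's theorem). Everything here is
proved; the file declares theorems only.

**Theorem** (`Literature.Topology.FourManifolds.Link.exists_diffeomorph_tubularNbhd_rotate`). Let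
`νᵢ`, `ν'ᵢ : S¹ × ℝ² ↪ S³` be two families of oriented tubular neighbourhoods of the components of a
link `L` in `S³` (finitely many components), each family with pairwise disjoint images. Then there
are a diffeomorphism `ψ` of `S³` fixing every component of `L` pointwise, a radius `0 < r ≤ 1` and
integers `dᵢ` with

  `ψ (νᵢ (e^{iθ}, w)) = ν'ᵢ (e^{iθ}, R(dᵢ θ) w)`   (`‖w‖ < r`),

i.e. near the link `ψ ∘ νᵢ` is `ν'ᵢ` up to the rotation of the fibre over `e^{iθ}` through the
angle `dᵢ θ`.

This is the tree's uniqueness of tubular neighbourhoods up to rotation of the fibres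
(`Literature.Topology.FourManifolds.Link.exists_diffeomorph_tubularNbhd'`, `LinkTubularUniqueness.lean`:
`φ (νᵢ (x, w)) = ν'ᵢ (x, uᵢ(x) · w)` for a smooth rotation field `uᵢ : S¹ → S¹`; Hirsch,
*Differential Topology* (1976), Ch. 4 §5 Thm. 5.3 with Ch. 8 §1 Thm. 1.3), followed by the
**untwisting of the null-homotopic part of the rotation field**: a lift `Φᵢ : ℝ → ℝ` of
`uᵢ ∘ circlePoint` (`CircleDiffeotopyProofs.lean`: `exists_continuous_lift`, smooth by
`contDiff_of_circlePoint_comp_eq`) satisfies `Φᵢ (θ + 2π) = Φᵢ θ + 2π dᵢ` (`dᵢ` the degree of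
`uᵢ`, `exists_int_apply_add_two_pi`), so `Φᵢ θ - dᵢ θ` is `2π`-periodic and descends to a smooth
angle function `βᵢ : S¹ → ℝ` (`exists_contMDiff_comp_circlePoint_eq`), and the fibre twist of `S³`
along the `ν'ᵢ` by `-βᵢ` (`Literature.Topology.FourManifolds.Link.exists_diffeomorph_fibreTwist'`,
`TubeTwistDiffeo.lean`; Hirsch (1976), Ch. 8 §1) composed with `φ` leaves exactly the rotations
`R(dᵢ θ)`. Downstream (`Knot.TubularNbhd.HasFraming.eq_sub_of_rotate`,
`TubularNbhdRotationDegree.lean`) equality of the framing integers forces `dᵢ = 0`, which is the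
uniqueness of *framed* tubular neighbourhoods used by the uniqueness of surgery (Rolfsen, *Knots
and Links* (1976), §9.F; Gompf–Stipsicz (1999), §4.5).

## References

* M. W. Hirsch, *Differential Topology*, GTM 33, Springer (1976), Ch. 4 §5 Thm. 5.3, Ch. 8 §1.
  [cite: Hirsch1976, Ch. 4 §5 Thm. 5.3]
* D. Rolfsen, *Knots and Links* (1976), §9.F. [cite: Rolfsen1976, §9.F]

## Design notes

* The descended function is `u ↦ P (2π · angA u)`, the real-valued analogue of the tree's
  `circleDescend` (`CircleDiffeotopyProofs.lean`), smooth for `2π`-periodic smooth `P` by the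
  usual switch to the angle function `angB` near `ptA` (`TorusCoordinates.lean`); it is provided by
  an existence theorem so that the file stays a pure proof file.
* No declaration in this file uses `sorry`.
-/

noncomputable section

open Set Function
open scoped Manifold ContDiff Topology Real

namespace Literature.Topology.FourManifolds

/-! ### Descending a `2π`-periodic function of the angle to the circle -/

section RealDescend

/-- **A `2π`-periodic `C^∞` function of the angle is a `C^∞` function on the circle**: there is a
`C^∞` `β : S¹ → ℝ` with `β (circlePoint θ) = P θ` (namely `β u = P (2π · angA u)`, computed with
`angB` near `ptA`). [folklore] -/
theorem exists_contMDiff_comp_circlePoint_eq {P : ℝ → ℝ} (hP : Periodic P (2 * π))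
    (hs : ContDiff ℝ ∞ P) :
    ∃ β : Metric.sphere (0 : EuclideanSpace ℝ (Fin 2)) 1 → ℝ,
      ContMDiff (𝓡 1) 𝓘(ℝ, ℝ) ∞ β ∧ ∀ θ, β (circlePoint θ) = P θ := by
  have hA : ∀ θ, P (2 * π * angA (circlePoint θ)) = P θ := fun θ ↦
    Periodic.eq_of_circlePoint_eq hP (circlePoint_two_pi_mul_angA (circlePoint θ))
  have hB : ∀ u, P (2 * π * angA u) = P (2 * π * angB u) := fun u ↦
    Periodic.eq_of_circlePoint_eq hP
      (by rw [circlePoint_two_pi_mul_angA, circlePoint_two_pi_mul_angB])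
  refine ⟨fun u ↦ P (2 * π * angA u), fun u ↦ ?_, hA⟩
  by_cases hu : u = ptA
  · have hne : u ≠ ptB := hu ▸ ptA_ne_ptB
    have heq : (fun u ↦ P (2 * π * angA u)) = (fun θ : ℝ ↦ P (2 * π * θ)) ∘ angB :=
      funext fun v ↦ hB v
    rw [heq]
    exact (hs.comp (contDiff_const.mul contDiff_id)).contDiffAt.comp_contMDiffAt
      (contMDiffAt_angB hne)
  · have heq : (fun u ↦ P (2 * π * angA u)) = (fun θ : ℝ ↦ P (2 * π * θ)) ∘ angA := rfl
    rw [heq]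
    exact (hs.comp (contDiff_const.mul contDiff_id)).contDiffAt.comp_contMDiffAt
      (contMDiffAt_angA hu)

end RealDescend

/-! ### Smooth rotation fields: lift, degree and periodic part -/

section RotationField

/-- **Decomposition of a smooth rotation field.** A smooth map `u : S¹ → S¹` is
`u (circlePoint θ) = circlePoint (d θ + β (circlePoint θ))` for an integer `d` (its degree) and a
smooth real function `β` on the circle: lift `u ∘ circlePoint` to `Φ : ℝ → ℝ` (covering space
theory of `circlePoint : ℝ → S¹`, `CircleDiffeotopyProofs.lean`), let `d` be its degree
(`Φ (θ + 2π) = Φ θ + 2πd`) and descend the `2π`-periodic `Φ θ - dθ`. Hirsch (1976), proof of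
Thm. 8.3.3 (degree of a circle map via its lift). [folklore] -/
theorem exists_int_contMDiff_rotationField
    {u : Metric.sphere (0 : EuclideanSpace ℝ (Fin 2)) 1 → Metric.sphere (0 : EuclideanSpace ℝ (Fin 2)) 1}
    (hu : ContMDiff (𝓡 1) (𝓡 1) ∞ u) :
    ∃ (d : ℤ) (β : Metric.sphere (0 : EuclideanSpace ℝ (Fin 2)) 1 → ℝ),
      ContMDiff (𝓡 1) 𝓘(ℝ, ℝ) ∞ β ∧
      ∀ θ : ℝ, u (circlePoint θ) = circlePoint (d * θ + β (circlePoint θ)) := by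
  obtain ⟨Φ, hΦc, hΦ⟩ := exists_continuous_lift hu.continuous
  have hΦs : ContDiff ℝ ∞ Φ :=
    contDiff_of_circlePoint_comp_eq (hu.comp contMDiff_circlePoint) hΦc hΦ
  obtain ⟨d, hd⟩ := exists_int_apply_add_two_pi hΦc hΦ
  -- the periodic part `Φ θ - dθ`
  have hPper : Periodic (fun θ ↦ Φ θ - d * θ) (2 * π) := fun θ ↦ by
    simp only [hd θ]
    ring
  have hPs : ContDiff ℝ ∞ (fun θ ↦ Φ θ - d * θ) := hΦs.sub (contDiff_const.mul contDiff_id)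
  obtain ⟨β, hβ, hβP⟩ := exists_contMDiff_comp_circlePoint_eq hPper hPs
  refine ⟨d, β, hβ, fun θ ↦ ?_⟩
  rw [hβP, ← hΦ θ]
  congr 1
  ring

end RotationField

/-! ### The untwisting -/

section Untwist

variable {ι : Type*} [Finite ι]

namespace Link

/-- **Two families of tubular neighbourhoods of a link agree near the link up to the rotations
`R(dᵢ θ)`.** For oriented tubular neighbourhoods `νᵢ`, `ν'ᵢ` of the components of a link `L`
(each family with pairwise disjoint images) there are a diffeomorphism `ψ` of `S³` fixing every
component pointwise, a radius `0 < r ≤ 1` and integers `dᵢ` with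
`ψ (νᵢ (circlePoint θ, w)) = ν'ᵢ (circlePoint θ, rotPlane (dᵢ θ) w)` for `‖w‖ < r`: the
uniqueness of tubular neighbourhoods up to a smooth rotation field `uᵢ`
(`Link.exists_diffeomorph_tubularNbhd'`; Hirsch (1976), Ch. 4 §5 Thm. 5.3, Ch. 8 §1 Thm. 1.3),
the decomposition `uᵢ (e^{iθ}) = e^{i (dᵢ θ + βᵢ)}` (`exists_int_contMDiff_rotationField`) and
the fibre twist of `S³` along the `ν'ᵢ` by `-βᵢ` (`Link.exists_diffeomorph_fibreTwist'`; Hirsch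
(1976), Ch. 8 §1). [cite: Hirsch1976, Ch. 4 §5 Thm. 5.3] -/
theorem exists_diffeomorph_tubularNbhd_rotate (L : Link ι)
    (ν ν' : ∀ i, Knot.TubularNbhd (L.component i))
    (hdisj : Pairwise fun i j ↦ Disjoint (range (ν i)) (range (ν j)))
    (hdisj' : Pairwise fun i j ↦ Disjoint (range (ν' i)) (range (ν' j))) :
    ∃ ψ : Metric.sphere (0 : EuclideanSpace ℝ (Fin 4)) 1 ≃ₘ⟮𝓡 3, 𝓡 3⟯
        Metric.sphere (0 : EuclideanSpace ℝ (Fin 4)) 1,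
      (∀ i x, ψ (L.component i x) = L.component i x) ∧
      ∃ r : ℝ, 0 < r ∧ r ≤ 1 ∧ ∃ d : ι → ℤ, ∀ i (θ : ℝ) (w : EuclideanSpace ℝ (Fin 2)), ‖w‖ < r →
        ψ (ν i (circlePoint θ, w)) = ν' i (circlePoint θ, rotPlane (d i * θ) w) := by
  obtain ⟨φ, hφL, u, hu, r, hr, hφν⟩ := L.exists_diffeomorph_tubularNbhd' ν ν' hdisj hdisj'
  choose d β hβ hdβ using fun i ↦ exists_int_contMDiff_rotationField (hu i)
  obtain ⟨ρ, hρν, hρL, -⟩ :=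
    L.exists_diffeomorph_fibreTwist' ν' hdisj' (fun i x ↦ -β i x) fun i ↦ (hβ i).neg
  refine ⟨φ.trans ρ, fun i x ↦ ?_, min r 1, lt_min hr one_pos, min_le_right _ _, d,
    fun i θ w hw ↦ ?_⟩
  · rw [Diffeomorph.coe_trans, comp_apply, hφL, hρL]
  have hwr : ‖w‖ < r := hw.trans_le (min_le_left _ _)
  -- `φ` in terms of the rotation `R(dᵢ θ + βᵢ)`
  have hrot : w 0 • ((u i (circlePoint θ) : Metric.sphere (0 : EuclideanSpace ℝ (Fin 2)) 1) :
      EuclideanSpace ℝ (Fin 2)) + w 1 • quarterTurn ((u i (circlePoint θ) :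
        Metric.sphere (0 : EuclideanSpace ℝ (Fin 2)) 1) : EuclideanSpace ℝ (Fin 2)) =
        rotPlane (d i * θ + β i (circlePoint θ)) w := by
    rw [hdβ i θ]
    exact (rotPlane_eq_of_cos_sin (circlePoint_apply_zero _) (circlePoint_apply_one _) w).symm
  have hw1 : ‖rotPlane (d i * θ + β i (circlePoint θ)) w‖ ≤ 1 := by
    rw [norm_rotPlane]
    exact (hw.trans_le (min_le_right _ _)).le
  rw [Diffeomorph.coe_trans, comp_apply, hφν i _ w hwr, hrot, hρν i _ _ hw1, ← rotPlane_add]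
  congr 2
  ring

end Link

end Untwist

end Literature.Topology.FourManifolds
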